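import Summits.ValiantsHypothesis.ValiantsHypothesis.Theorems.BarrierLeverChowThinRowsAllColumns
import Summits.ValiantsHypothesis.ValiantsHypothesis.Theorems.BarrierLeverPartitionMinorsChowSwap

/-!
# Route BarrierLever — items 20172 / 20195: ARBITRARY rows × FIRST-ORDER columns, every height

Helper file (`--supports stmt-ValiantsHypothesis-20195`; cell valiant-natproofs, rung V4, 𝒟-side of
door (c); seat val-np-p2 gen 7).  Closes NO item; definition-free.  Conventions of items 19717 /
20172 / 20195: `x_a = X (castAdd h a)`, `y_c = X (natAdd h c)`; a layout `(u, w)` is CHOW-HIT when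
some product of `h + h` affine forms has `det[coeff_{E (u i) (w j)} ∏ ℓ] ≠ 0`.

`chowHits_firstOrderColumns` — for every height `h ≥ 1`, all injective rows `u i ⊆ Fin h` of ANY
sizes and all injective columns `w j` of size `≤ 1`, the layout is Chow-hit.  This is the `x ↔ y`
mirror (`ChowFactor.chow_hit_swap`, val-np-p4) of val-np-p7's unrestricted first-order-rows theorem
`ChowThinAll.chowHits_firstOrderRows`; it removes the budget hypothesis of prover g10's
`ChowSubcube.chowHits_downClosedRows_firstOrderColumns` (rows in a down-closed family of `≤ 2h` sets)
and the empty-row hypothesis `∃ i₀, u i₀ = ∅` of val-np-p8's `ChowSubcube.chowHits_thinRows_starColumns`.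
Corollary `chowHitsThinRowPartitionMinors_firstOrderColumns`: item 20195's statement verbatim on its
star-column layer with NO further hypothesis (`h₀ = 1`).

Why it is recorded: in the seat's engine census (memo HOME/val-np-p2/g7/MEMO-dense-engine-g7.md) the
only thin layouts of height `≤ 4` not reduced by the tree's moves to the tree's leaves or to the
x-private design (`…ChowComplementaryProducts`) have star-heavy columns and rows without `∅`; the
pure star-column ones are exactly this corollary.  WHAT THIS IS NOT: columns of size `≥ 2` are not
touched; nothing on items 20172 / 20195 / 19717 themselves, on crux stmt-ValiantsHypothesis-14610,
or on `VP` versus `VNP`.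
-/

set_option linter.dupNamespace false

namespace Summit.ValiantsHypothesis.ValiantsHypothesis.Theorems.BarrierLever.ChowThinAll

open Finset MvPolynomial

/-- **ARBITRARY rows × first-order columns, every height `h ≥ 1`**: injective rows of any sizes,
injective columns of size `≤ 1` ⇒ some product of `h + h` affine forms has a nonsingular partition
minor (the `x ↔ y` mirror of `chowHits_firstOrderRows`). -/
theorem chowHits_firstOrderColumns (h : ℕ) (hh : 1 ≤ h) (r : ℕ) (u w : Fin r → Finset (Fin h))
    (hu : Function.Injective u) (hw : Function.Injective w) (hw1 : ∀ j, (w j).card ≤ 1) :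
    ∃ ℓ : Fin (h + h) → MvPolynomial (Fin (h + h)) ℂ, (∀ k, (ℓ k).totalDegree ≤ 1) ∧
      (Matrix.of fun i j : Fin r => MvPolynomial.coeff
        (∑ a ∈ u i, Finsupp.single (Fin.castAdd h a) 1 +
          ∑ c ∈ w j, Finsupp.single (Fin.natAdd h c) 1) (∏ k, ℓ k)).det ≠ 0 :=
  ChowFactor.chow_hit_swap u w (chowHits_firstOrderRows h hh r w u hw hu hw1)

/-- **Star-column slice of item 20195 with no empty-row hypothesis**: `ChowHitsThinRowPartitionMinors`
verbatim restricted to columns of size `≤ 1`, with `h₀ = 1` (the thinness of the rows is not used). -/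
theorem chowHitsThinRowPartitionMinors_firstOrderColumns :
    ∃ h₀ : ℕ, ∀ h : ℕ, h₀ ≤ h → ∀ (r : ℕ) (u w : Fin r → Finset (Fin h)),
      Function.Injective u → Function.Injective w → (∀ i, (u i).card ≤ 2) →
        (∀ j, (w j).card ≤ 1) →
        ∃ ℓ : Fin (h + h) → MvPolynomial (Fin (h + h)) ℂ, (∀ k, (ℓ k).totalDegree ≤ 1) ∧
          (Matrix.of fun i j : Fin r => MvPolynomial.coeff
            (∑ a ∈ u i, Finsupp.single (Fin.castAdd h a) 1 +
              ∑ c ∈ w j, Finsupp.single (Fin.natAdd h c) 1) (∏ k, ℓ k)).det ≠ 0 :=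
  ⟨1, fun h hh r u w hu hw _ hw1 => chowHits_firstOrderColumns h hh r u w hu hw hw1⟩

end Summit.ValiantsHypothesis.ValiantsHypothesis.Theorems.BarrierLever.ChowThinAll
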